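import Literature.Geometry.GeometricMeasureTheory.CurrentsSupportTheorem
import HarnessLib

/-!
# Federer's support theorem, locally rectifiable form

The proof of `Federer1969_support_integralFlatChain_holds` (`CurrentsSupportTheorem.lean`,
[Federer, *Geometric Measure Theory*, 4.1.20]) never uses the compactness of the supports of `R`
and `S` in `T = R + ∂S`: the localisation is done by the test form. We record the resulting
**local** statement, which is the one needed for currents that are only locally rectifiable
(e.g. the current of integration `[T]` of a holomorphic chain, whose support is not compact):

* `Current.add_boundary_eq_zero_of_isLocallyRectifiable` — if `R ∈ 𝓡^{loc}_{m+1}(Ω)`,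
  `S ∈ 𝓡^{loc}_{m+2}(Ω)` and `𝓗^{m+1}(spt (R + ∂S)) = 0`, then `R + ∂S = 0`;
* `Current.boundary_eq_zero_of_isLocallyRectifiable` — the case `R = 0`: a locally rectifiable
  current whose boundary has `𝓗^{m+1}`-null support is a cycle (used for `d[T] = 0`,
  [Harvey1977, Lemma 1.8]).

The proof is Federer's (4.1.20), exactly as in `CurrentsSupportTheorem.lean`: expand a test form as
`Σ_λ φ_λ • 𝐩_λ^♯(DY)`, and kill each term with `apply_smulCovector_pullbackDet_eq_zero`, the frames
being degenerate under `𝐩_λ` a.e. over the Lebesgue-null compact set `𝐩_λ(spt T ∩ spt φ_λ)`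
(`ae_map_span_frame_ne_top`).

## References

* H. Federer, *Geometric Measure Theory*, Springer 1969, 4.1.20 (with 4.1.1, 4.1.6, 4.1.28).
* R. Harvey, *Holomorphic chains and their boundaries*, PSPUM XXX.1 (1977), Lemma 1.8.
-/

noncomputable section

open scoped Distributions ENNReal NNReal Topology
open MeasureTheory TopologicalSpace Set Filter Module

namespace Literature.Geometry.GeometricMeasureTheory

set_option maxSynthPendingDepth 2

open Set.powersetCard

variable {V : Type*} [NormedAddCommGroup V] [InnerProductSpace ℝ V] [FiniteDimensional ℝ V]
  [MeasurableSpace V] [BorelSpace V] {Ω : Opens V} {m : ℕ}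

/-- **Support theorem, locally rectifiable form.** Let `R` be a locally rectifiable
`(m+1)`-current and `S` a locally rectifiable `(m+2)`-current in `Ω` (no compactness of supports),
and suppose `𝓗^{m+1}(spt (R + ∂S)) = 0`. Then `R + ∂S = 0`. Federer's proof of 4.1.20 for
`T = R + ∂S ∈ 𝓕_{m+1}` uses only the integral representation of `R` and `S` with locally summable
densities and the relative closedness of `spt T` (the test form localises everything), hence applies
verbatim. [cite: Federer1969, 4.1.20 (with 3.2.19, 3.2.22, 4.1.6, 4.1.28)] -/
theorem Current.add_boundary_eq_zero_of_isLocallyRectifiable {R : Current Ω (m + 1)}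
    {S : Current Ω (m + 1 + 1)} (hR : R.IsLocallyRectifiable) (hS : S.IsLocallyRectifiable)
    (h0 : (μHE[m + 1] : Measure V) (R + S.boundary).support = 0) : R + S.boundary = 0 := by
  classical
  obtain ⟨W, θ, ξ, hdR, hReq⟩ := hR
  obtain ⟨W', θ', ξ', hdS, hSeq⟩ := hS
  set T : Current Ω (m + 1) := R + S.boundary with hTdef
  -- `𝓗^{m+1}(spt T) = 0` for the unnormalised Hausdorff measure as well
  have hH0 : (μH[((m + 1 : ℕ) : ℝ)] : Measure V) T.support = 0 := by
    rw [Measure.euclideanHausdorffMeasure_def, Measure.smul_apply, smul_eq_zero] at h0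
    exact h0.resolve_left (Measure.addHaarScalarFactor_volume_hausdorffMeasure_ne_zero (m + 1))
  -- the key step: `T(ψ • P^♯ DY) = 0`
  have key : ∀ (P : V →L[ℝ] (Fin (m + 1) → ℝ)) (ψ : 𝓓(Ω, ℝ)),
      T (smulCovectorCLM (pullbackDet P) ψ) = 0 := by
    intro P ψ
    set C : Set (Fin (m + 1) → ℝ) := P '' (T.support ∩ tsupport ⇑ψ) with hC
    -- `C` is compact and Lebesgue-null
    have hKc : IsCompact (T.support ∩ tsupport ⇑ψ) := by
      have e : T.support ∩ tsupport ⇑ψ = tsupport ⇑ψ \ ((Ω : Set V) \ T.support) := by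
        ext x
        constructor
        · rintro ⟨hxT, hxψ⟩
          exact ⟨hxψ, fun h => h.2 hxT⟩
        · rintro ⟨hxψ, hx⟩
          exact ⟨by_contra fun hxT => hx ⟨ψ.tsupport_subset hxψ, hxT⟩, hxψ⟩
      rw [e]
      exact ψ.hasCompactSupport.of_isClosed_subset
        ((isClosed_tsupport _).sdiff T.isOpen_sdiff_support) sdiff_subset
    have hCcl : IsClosed C := (hKc.image P.continuous).isClosed
    have hCvol : volume C = 0 := by
      have h1 : (μH[((m + 1 : ℕ) : ℝ)] : Measure (Fin (m + 1) → ℝ)) (P '' T.support) = 0 := by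
        refine nonpos_iff_eq_zero.1 ((P.lipschitz.hausdorffMeasure_image_le (by positivity)
          T.support).trans ?_)
        rw [hH0, mul_zero]
      have h2 : (μH[((m + 1 : ℕ) : ℝ)] : Measure (Fin (m + 1) → ℝ)) = volume := by
        have := hausdorffMeasure_pi_real (ι := Fin (m + 1))
        rwa [Fintype.card_fin] at this
      rw [← h2]
      exact measure_mono_null (image_mono inter_subset_left) h1
    refine apply_smulCovector_pullbackDet_eq_zero (T := T) (R := R) (S := S) rfl hReq hdR.2.2.2.1
      hSeq hdS.2.2.2.1 P ψ hCcl subset_rfl ?_ ?_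
    · have hae := ae_map_span_frame_ne_top hdR.1 hdR.2.2.1
        (hdR.2.2.2.2.mono fun x hx => hx.2) P volume hCvol
      filter_upwards [hae] with x hx hPx
      exact pullbackDet_apply_eq_zero_of_map_span_ne_top P (ξ x) (hx hPx) (ξ x)
        fun i => mem_range_self i
    · have hae := ae_map_span_frame_ne_top hdS.1 hdS.2.2.1
        (hdS.2.2.2.2.mono fun x hx => hx.2) P volume hCvol
      filter_upwards [hae] with x hx hPx i
      exact pullbackDet_apply_eq_zero_of_map_span_ne_top P (ξ' x) (hx hPx)
        (Fin.removeNth i (ξ' x)) fun a => mem_range_self _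
  -- expansion of an arbitrary test form in product test forms
  ext φ
  have hφ := congrArg T (testForm_eq_sum (Module.finBasis ℝ V) φ)
  rw [_root_.map_sum] at hφ
  rw [hφ]
  exact Finset.sum_eq_zero fun s _ => key _ _

/-- **A locally rectifiable current whose boundary has `𝓗^{m+1}`-null support is a cycle**:
if `S ∈ 𝓡^{loc}_{m+2}(Ω)` and `𝓗^{m+1}(spt ∂S) = 0` then `∂S = 0` (the case `R = 0` of
`Current.add_boundary_eq_zero_of_isLocallyRectifiable`). This is how `d[T] = 0` for a holomorphic
chain `T` follows from `spt d[T] ⊆ Sing |T|` and `𝓗^{2p-1}(Sing |T|) = 0`.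
[cite: Federer1969, 4.1.20; Harvey1977, Lemma 1.8] -/
theorem Current.boundary_eq_zero_of_isLocallyRectifiable {S : Current Ω (m + 1 + 1)}
    (hS : S.IsLocallyRectifiable)
    (h0 : (μHE[m + 1] : Measure V) S.boundary.support = 0) : S.boundary = 0 := by
  have h := Current.add_boundary_eq_zero_of_isLocallyRectifiable (R := 0)
    Current.isLocallyRectifiable_zero hS (by rwa [zero_add])
  rwa [zero_add] at h

end Literature.Geometry.GeometricMeasureTheory
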